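import Literature.NumberTheory.Sieve.MoebiusVaughanInverse

/-!
# Route `GreenTaoLevelTwo`, crux `MNTwo` (stmt-Parity-21276), line `birth`, stub `stub_mnVertical`:
# the type I / type II dichotomy for `∑_{N<n≤2N} μ(n)F(n)` (GT 2008b §10, via Prop. 9)

Block V4 / H1 of the `stub_mnVertical` census (B. Green, T. Tao, *Quadratic uniformity of the
Möbius function*, Ann. Inst. Fourier 58 (2008) = arXiv:math/0606087, §10: "We now apply
Proposition (inverse-prop) with `f(n) := ψ(n)e(φ(n))` and `U = V = N^{1/3}` to conclude one of the
following statements must be true: (Type I sum is large) …; (Type II sum is large) …").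

Def-free wrapper, for an ARBITRARY `1`-bounded `F : ℕ → ℂ` vanishing on `[0, N]` (the structure
`ψ e(φ)` is irrelevant here), around the tree's Vaughan identity and inverse theorems
(`QuadraticMoebius.norm_sum_moebius_mul_le_vaughan`, `typeI_inverse`, `typeII_inverse`, applied on
`[1, 2N]` with `U = V = u`); the polylogarithmic thresholds are kept as explicit hypotheses
(`hthrI`, `hthrII`) to be discharged by the §10 assembly, and the type II output is also recast in
the "`X`-form" `‖∑_w ∑_{d∼K} b₂(w) b₁(d) F(dw)‖ ≳ N` with `1`-bounded `b₁, b₂` used by Lemma 24.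

* `sum_Icc_eq_sum_Ioc_of_vanish` — `∑_{n≤2N} μF = ∑_{N<n≤2N} μF` when `F = 0` on `[0,N]`;
* `dichotomy` — large `∑_{N<n≤2N} μ F` ⇒ (type I large for many `d ∼ 2^j ≤ u²`) or (type II large);
* `map_natCast_Icc`, `sum_typeI_nat_eq_int`, `vanish_off_Icc`, `length_Icc_le` — recasting the
  type I output in the `ℤ`-indexed form of `…MNTwoTypeIMajorArc.typeI_major_arc`;
* `typeII_Xform` — the type II output in `X`-form with bounded coefficients `b₁, b₂`.

References: [GreenTao2008QuadraticMobius] arXiv:math/0606087 §4 Prop. 9, §10 (typeI/II-complex).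
-/

noncomputable section

open Finset Real ArithmeticFunction
open scoped ArithmeticFunction.Moebius ComplexConjugate

namespace Summit.Parity.GeneralizedHardyLittlewood.GreenTaoLevelTwoMNTwoDichotomy

open Literature.NumberTheory.Sieve (moebiusTrunc)
open Literature.NumberTheory.Sieve.QuadraticMoebius (norm_sum_moebius_mul_le_vaughan typeI_inverse
  typeII_inverse)

/-- If `F` vanishes on `[0, N]` then `∑_{1≤n≤2N} μ(n)F(n) = ∑_{N<n≤2N} μ(n)F(n)`. [folklore] -/
theorem sum_Icc_eq_sum_Ioc_of_vanish (N : ℕ) (F : ℕ → ℂ) (hF0 : ∀ n, n ≤ N → F n = 0) :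
    ∑ n ∈ Icc 1 (2 * N), ((μ n : ℝ) : ℂ) * F n = ∑ n ∈ Ioc N (2 * N), ((μ n : ℝ) : ℂ) * F n := by
  symm
  apply Finset.sum_subset
  · intro n hn
    rw [mem_Ioc] at hn; rw [mem_Icc]; omega
  · intro n hn hn'
    rw [mem_Icc] at hn; rw [mem_Ioc, not_and_or, not_lt] at hn'
    rcases hn' with h | h
    · rw [hF0 n h, mul_zero]
    · omega

/-- **The type I / type II dichotomy (GT 2008b §10 via Prop. 9), explicit thresholds.**
Let `F : ℕ → ℂ` be `1`-bounded and vanish on `[0, N]`, `1 ≤ u`, `u² ≤ 2N`, and suppose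
`2u + 2X ≤ ‖∑_{N<n≤2N} μ(n)F(n)‖`.  If `η₁, η₂ > 0` satisfy the thresholds
`64η₁²(2N)²(1+log u²)⁴(log₂u²+1) ≤ X²` and `4η₂(2N)²(log₂(2N)+1)²(1+log 4N)³ ≤ X²`, then EITHER
(type I) for some `j ≤ log₂ u²` at least `η₁²2^j` integers `d ∈ [2^j,2^{j+1}) ∩ [1,u²]` have
`‖∑_{w ≤ 2N/d} F(dw)‖ ≥ η₁(2N)/2^j`, OR (type II) for some `K` with `u ≤ K`, `Ku ≤ 2N` and some
`w' ≤ 2N/K`, at least `η₂(2N/K) − 1` integers `w ≤ 2N/K`, `w ≠ w'`, have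
`‖∑_{K<d≤min(2K,2N/w,2N/w')} F(dw)conj F(dw')‖ ≥ η₂K`.
[cite: GreenTao2008QuadraticMobius, §10 (eqs. (typeI-complex), (typeII-complex)) and Prop. 9] -/
theorem dichotomy {N u : ℕ} (hN : 1 ≤ N) (hu : 1 ≤ u) (huN : u * u ≤ 2 * N)
    (F : ℕ → ℂ) (hF : ∀ n, ‖F n‖ ≤ 1) (hF0 : ∀ n, n ≤ N → F n = 0)
    {X η₁ η₂ : ℝ} (hX : 0 ≤ X) (hη₁ : 0 < η₁) (hη₂ : 0 < η₂)
    (hlarge : 2 * u + 2 * X ≤ ‖∑ n ∈ Ioc N (2 * N), ((μ n : ℝ) : ℂ) * F n‖)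
    (hthrI : 64 * η₁ ^ 2 * ((2 * N : ℕ) : ℝ) ^ 2 * (1 + Real.log ((u * u : ℕ) : ℝ)) ^ 4 *
      (Nat.log 2 (u * u) + 1) ≤ X ^ 2)
    (hthrII : 4 * η₂ * ((2 * N : ℕ) : ℝ) ^ 2 * ((Nat.log 2 (2 * N) : ℝ) + 1) ^ 2 *
      (1 + Real.log (2 * ((2 * N : ℕ) : ℝ))) ^ 3 ≤ X ^ 2) :
    (∃ j : ℕ, j ≤ Nat.log 2 (u * u) ∧
      η₁ ^ 2 * 2 ^ j ≤ #((Icc 1 (u * u)).filter fun d => Nat.log 2 d = j ∧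
        η₁ * ((2 * N : ℕ) : ℝ) / 2 ^ j ≤ ‖∑ w ∈ Icc 1 (2 * N / d), F (d * w)‖)) ∨
    (∃ K : ℕ, u ≤ K ∧ K * u ≤ 2 * N ∧ ∃ w' ∈ Icc 1 (2 * N / K),
      η₂ * ((2 * N / K : ℕ) : ℝ) - 1 ≤ #((Icc 1 (2 * N / K)).filter fun w => w ≠ w' ∧
        η₂ * K ≤ ‖∑ d ∈ Ioc K (min (2 * K) (min (2 * N / w) (2 * N / w'))),
          F (d * w) * conj (F (d * w'))‖)) := by
  classical
  have hV := norm_sum_moebius_mul_le_vaughan u (2 * N) F hF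
  rw [sum_Icc_eq_sum_Ioc_of_vanish N F hF0] at hV
  -- one of the two sums is `≥ X`
  generalize hTI : ‖∑ d ∈ Icc 1 (2 * N), ((((moebiusTrunc u : ArithmeticFunction ℝ) *
      (moebiusTrunc u : ArithmeticFunction ℝ)) d : ℝ) : ℂ) * ∑ w ∈ Icc 1 (2 * N / d), F (d * w)‖ = TI
    at hV
  generalize hTII : ‖∑ d ∈ Icc 1 (2 * N), ((Literature.NumberTheory.Sieve.Vaughan.gU u d : ℝ) : ℂ) *
      ∑ w ∈ Icc 1 (2 * N / d), ((((μ : ArithmeticFunction ℝ) -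
        (moebiusTrunc u : ArithmeticFunction ℝ)) w : ℝ) : ℂ) * F (d * w)‖ = TII at hV
  have hsum : 2 * X ≤ TI + TII := by linarith
  by_cases hI : X ≤ TI
  · left
    have hlargeI : 64 * η₁ ^ 2 * ((2 * N : ℕ) : ℝ) ^ 2 * (1 + Real.log ((u * u : ℕ) : ℝ)) ^ 4 *
        (Nat.log 2 (u * u) + 1) ≤ TI ^ 2 :=
      hthrI.trans (pow_le_pow_left₀ hX hI 2)
    rw [← hTI] at hlargeI
    have hUU1 : 1 ≤ u * u := Nat.one_le_iff_ne_zero.mpr (Nat.mul_ne_zero (by omega) (by omega))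
    exact typeI_inverse (N := 2 * N) (U := u * u) hUU1 huN
      (a := fun d => (((moebiusTrunc u : ArithmeticFunction ℝ) *
          (moebiusTrunc u : ArithmeticFunction ℝ)) d : ℝ))
      (fun d => Literature.NumberTheory.Sieve.MoebiusExpSum.abs_trunc_mul_trunc_le u d)
      (fun d hd => Literature.NumberTheory.Sieve.MoebiusExpSum.trunc_mul_trunc_eq_zero_of_lt hd)
      F hF hη₁ hlargeI
  · right
    push Not at hI
    have hII : X ≤ TII := by linarith
    have hlargeII : 4 * η₂ * ((2 * N : ℕ) : ℝ) ^ 2 * ((Nat.log 2 (2 * N) : ℝ) + 1) ^ 2 *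
        (1 + Real.log (2 * ((2 * N : ℕ) : ℝ))) ^ 3 ≤ TII ^ 2 :=
      hthrII.trans (pow_le_pow_left₀ hX hII 2)
    rw [← hTII] at hlargeII
    have h2N : 2 ≤ 2 * N := by omega
    obtain ⟨K, huK, hKu, w', hw', hgood⟩ := typeII_inverse (N := 2 * N) (u := u) h2N hu
      (b := fun d => (Literature.NumberTheory.Sieve.Vaughan.gU u d : ℝ))
      (c := fun w => (((μ : ArithmeticFunction ℝ) - (moebiusTrunc u : ArithmeticFunction ℝ)) w : ℝ))
      (fun d => by
        have := Literature.NumberTheory.Sieve.Vaughan.abs_gU_le u d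
        rwa [ArithmeticFunction.sigma_zero_apply] at this)
      (fun d hd => Literature.NumberTheory.Sieve.Vaughan.gU_eq_zero_of_le hd)
      (fun w => Literature.NumberTheory.Sieve.MoebiusExpSum.abs_moebius_sub_trunc_le u w)
      (fun w hw => by
        rw [Literature.NumberTheory.Sieve.MoebiusExpSum.moebius_sub_trunc_apply, if_pos hw])
      F hF hη₂ hlargeII
    exact ⟨K, huK, hKu, w', hw', hgood⟩

/-! ### Recasting the type I output in `ℤ`-indexed form -/

/-- `{a, …, b} ⊂ ℕ` cast into `ℤ` is `{a, …, b} ⊂ ℤ`. [folklore] -/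
theorem map_natCast_Icc (a b : ℕ) :
    (Icc a b).map Nat.castEmbedding = Icc (a : ℤ) b := by
  ext x
  simp only [Finset.mem_map, Finset.mem_Icc, Nat.castEmbedding_apply]
  constructor
  · rintro ⟨n, ⟨h1, h2⟩, rfl⟩
    exact ⟨by exact_mod_cast h1, by exact_mod_cast h2⟩
  · rintro ⟨h1, h2⟩
    exact ⟨x.toNat, ⟨by omega, by omega⟩, Int.toNat_of_nonneg (by omega)⟩

/-- **Type I sums, `ℕ` versus `ℤ` indexing**: for `f : ℤ → ℂ` with `f(m) = 0` for `m ≤ N` and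
`d ≥ 1`, `∑_{w ∈ [1, M]} f(d·w) (over ℕ) = ∑_{w ∈ [0, M]} f(d·w) (over ℤ)`. [folklore] -/
theorem sum_typeI_nat_eq_int {N : ℕ} (f : ℤ → ℂ) (hf0 : ∀ m : ℤ, m ≤ N → f m = 0) (d M : ℕ) :
    ∑ w ∈ Icc 1 M, f ((d * w : ℕ) : ℤ) = ∑ w ∈ Icc (0 : ℤ) M, f ((d : ℤ) * w) := by
  have h0 : f ((d : ℤ) * 0) = 0 := by rw [mul_zero]; exact hf0 0 (by positivity)
  have hsplit : Icc (0 : ℤ) M = insert (0 : ℤ) (Icc (1 : ℤ) M) := by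
    ext x; simp only [mem_insert, mem_Icc]; omega
  have hmap : (Icc 1 M).map Nat.castEmbedding = Icc (1 : ℤ) M := by
    simpa using map_natCast_Icc 1 M
  rw [hsplit, Finset.sum_insert (by simp), h0, zero_add, ← hmap, Finset.sum_map]
  refine Finset.sum_congr rfl fun w _ => ?_
  simp only [Nat.castEmbedding_apply, Nat.cast_mul]

/-- **Support bookkeeping**: if `f(m) = 0` unless `N < m ≤ 2N`, and `d ≥ 1`, then `f(d·w) = 0` for
`w ∉ [0, 2N/d]`. [folklore] -/
theorem vanish_off_Icc {N : ℕ} (f : ℤ → ℂ) (hf : ∀ m : ℤ, ¬ ((N : ℤ) < m ∧ m ≤ 2 * N) → f m = 0)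
    {d : ℕ} (hd : 1 ≤ d) : ∀ w : ℤ, w ∉ Icc (0 : ℤ) ((2 * N / d : ℕ) : ℤ) → f ((d : ℤ) * w) = 0 := by
  intro w hw
  apply hf
  rw [mem_Icc, not_and_or, not_le, not_le] at hw
  rintro ⟨h1, h2⟩
  rcases hw with hw | hw
  · have : (d : ℤ) * w ≤ 0 := by
      have : (0 : ℤ) < d := by exact_mod_cast hd
      nlinarith
    have : (0 : ℤ) ≤ N := by positivity
    omega
  · -- `w ≥ 2N/d + 1`, so `d w ≥ d (2N/d + 1) > 2N`
    obtain ⟨q, hq⟩ : ∃ q : ℕ, q = 2 * N / d := ⟨_, rfl⟩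
    rw [← hq] at hw
    have hw' : (q : ℤ) + 1 ≤ w := hw
    have h3 : 2 * N < d * (q + 1) := by rw [hq]; exact Nat.lt_mul_div_succ (2 * N) hd
    have h4 : (d : ℤ) * ((q : ℤ) + 1) ≤ (d : ℤ) * w :=
      mul_le_mul_of_nonneg_left hw' (by positivity)
    have h5 : (2 * (N : ℤ)) < (d : ℤ) * ((q : ℤ) + 1) := by exact_mod_cast h3
    omega

/-- **Length bookkeeping**: for `1 ≤ d ≤ N`, `(2N/d) − 0 + 1 ≤ 3N/d`. [folklore] -/
theorem length_Icc_le {N d : ℕ} (hd : 1 ≤ d) (hdN : d ≤ N) :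
    (((((2 * N / d : ℕ) : ℤ)) - 0 + 1 : ℤ) : ℝ) ≤ 3 * (N : ℝ) / |((d : ℤ) : ℝ)| := by
  have hdr : (0 : ℝ) < d := by exact_mod_cast hd
  have h1 : (((2 * N / d : ℕ)) : ℝ) ≤ 2 * (N : ℝ) / d := by
    have := Nat.cast_div_le (m := 2 * N) (n := d) (α := ℝ)
    push_cast at this; exact this
  have h2 : (((2 * N / d : ℕ)) : ℝ) * d ≤ 2 * N := by
    rwa [le_div_iff₀ hdr] at h1
  have h3 : (d : ℝ) ≤ N := by exact_mod_cast hdN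
  obtain ⟨q, hq⟩ : ∃ q : ℕ, q = 2 * N / d := ⟨_, rfl⟩
  rw [← hq] at h2 ⊢
  have e : (((((q : ℕ) : ℤ)) - 0 + 1 : ℤ) : ℝ) = (q : ℝ) + 1 := by push_cast; ring
  rw [e, Int.cast_natCast, Nat.abs_cast, le_div_iff₀ hdr]
  nlinarith

/-! ### The type II output in `X`-form -/

/-- **Type II output in `X`-form.**  Let `F : ℕ → ℂ` be `1`-bounded with `F(n) = 0` for `n > 2N`,
and suppose that at least `m` integers `w ∈ [1, W]`, `w ≠ w'`, have
`‖∑_{K<d≤min(2K,2N/w,2N/w')} F(dw) conj F(dw')‖ ≥ Y` with `Y > 0`.  Then there are `1`-bounded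
`b₁, b₂ : ℕ → ℂ` with `m·Y ≤ ‖∑_{w ∈ [1,W]} ∑_{d ∈ (K,2K]} b₂(w) b₁(d) F(dw)‖`
(take `b₁(d) = conj F(dw')`, `b₂(w)` the conjugate phase of the inner sum on the good `w`).
[cite: GreenTao2008QuadraticMobius, §10 (proof of Lemma 24, "upon relabeling the bounded
functions `b` becomes simply `|X| ≳ 1`")] -/
theorem typeII_Xform {N K W w' : ℕ} (hw'1 : 1 ≤ w') (F : ℕ → ℂ) (hF : ∀ n, ‖F n‖ ≤ 1)
    (hF2 : ∀ n, 2 * N < n → F n = 0) {Y m : ℝ} (hY : 0 < Y)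
    (hgood : m ≤ #((Icc 1 W).filter fun w => w ≠ w' ∧
      Y ≤ ‖∑ d ∈ Ioc K (min (2 * K) (min (2 * N / w) (2 * N / w'))), F (d * w) * conj (F (d * w'))‖)) :
    ∃ b₁ b₂ : ℕ → ℂ, (∀ d, ‖b₁ d‖ ≤ 1) ∧ (∀ w, ‖b₂ w‖ ≤ 1) ∧
      m * Y ≤ ‖∑ w ∈ Icc 1 W, ∑ d ∈ Ioc K (2 * K), b₂ w * b₁ d * F (d * w)‖ := by
  classical
  set S := (Icc 1 W).filter fun w => w ≠ w' ∧
      Y ≤ ‖∑ d ∈ Ioc K (min (2 * K) (min (2 * N / w) (2 * N / w'))), F (d * w) * conj (F (d * w'))‖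
    with hS
  -- the inner sums over the full dyadic block
  set z : ℕ → ℂ := fun w => ∑ d ∈ Ioc K (2 * K), F (d * w) * conj (F (d * w')) with hz
  have hzeq : ∀ w ∈ Icc 1 W,
      ∑ d ∈ Ioc K (min (2 * K) (min (2 * N / w) (2 * N / w'))), F (d * w) * conj (F (d * w')) =
        z w := by
    intro w hw
    have hw0 : 0 < w := (mem_Icc.mp hw).1
    simp only [hz]
    apply Finset.sum_subset
    · intro d hd
      simp only [mem_Ioc, le_min_iff] at hd ⊢
      exact ⟨hd.1, hd.2.1⟩
    · intro d hd hd'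
      simp only [mem_Ioc, le_min_iff, not_and_or, not_le] at hd hd'
      rcases hd' with h | h | h | h
      · omega
      · omega
      · -- `d > 2N/w`: `F(dw) = 0`
        have : 2 * N < d * w := by
          rw [Nat.div_lt_iff_lt_mul hw0] at h; exact h
        rw [hF2 _ this, zero_mul]
      · -- `d > 2N/w'`: `F(dw') = 0`
        have : 2 * N < d * w' := by
          rw [Nat.div_lt_iff_lt_mul (by omega)] at h; exact h
        rw [hF2 _ this, _root_.map_zero, mul_zero]
  have hSz : ∀ w ∈ S, Y ≤ ‖z w‖ := by
    intro w hw
    rw [hS, mem_filter] at hw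
    rw [← hzeq w hw.1]; exact hw.2.2
  have hzne : ∀ w ∈ S, z w ≠ 0 := by
    intro w hw h0
    have := hSz w hw; rw [h0, norm_zero] at this; linarith
  have hzne' : ∀ w ∈ S, ((‖z w‖ : ℝ) : ℂ) ≠ 0 := fun w hw => by
    exact_mod_cast norm_ne_zero_iff.mpr (hzne w hw)
  -- the coefficients
  set b₂ : ℕ → ℂ := fun w => if w ∈ S then conj (z w) / ((‖z w‖ : ℝ) : ℂ) else 0 with hb₂
  have hb₂S : ∀ w ∈ S, b₂ w = conj (z w) / ((‖z w‖ : ℝ) : ℂ) := fun w hw => by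
    simp only [hb₂, if_pos hw]
  have hb₂S' : ∀ w, w ∉ S → b₂ w = 0 := fun w hw => by simp only [hb₂, if_neg hw]
  refine ⟨fun d => conj (F (d * w')), b₂,
    fun d => by rw [Complex.norm_conj]; exact hF _, fun w => ?_, ?_⟩
  · by_cases hw : w ∈ S
    · rw [hb₂S w hw, norm_div, Complex.norm_conj, Complex.norm_real, Real.norm_eq_abs,
        abs_of_nonneg (norm_nonneg _), div_self (norm_ne_zero_iff.mpr (hzne w hw))]
    · rw [hb₂S' w hw, norm_zero]; exact zero_le_one
  -- the double sum equals `∑_{w ∈ S} ‖z w‖`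
  have hinner : ∀ w ∈ Icc 1 W,
      ∑ d ∈ Ioc K (2 * K), b₂ w * conj (F (d * w')) * F (d * w) =
        if w ∈ S then ((‖z w‖ : ℝ) : ℂ) else 0 := by
    intro w _
    by_cases hw : w ∈ S
    · rw [if_pos hw]
      have e : ∑ d ∈ Ioc K (2 * K), b₂ w * conj (F (d * w')) * F (d * w) = b₂ w * z w := by
        rw [hz, Finset.mul_sum]
        exact Finset.sum_congr rfl fun d _ => by ring
      rw [e, hb₂S w hw, div_mul_eq_mul_div, Complex.conj_mul', div_eq_iff (hzne' w hw)]
      ring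
    · rw [if_neg hw, hb₂S' w hw]
      simp only [zero_mul, Finset.sum_const_zero]
  rw [Finset.sum_congr rfl hinner, ← Finset.sum_filter]
  have hfilt : (Icc 1 W).filter (fun w => w ∈ S) = S := by
    ext w
    simp only [mem_filter, hS]
    tauto
  rw [hfilt]
  have hre : ∑ w ∈ S, ((‖z w‖ : ℝ) : ℂ) = ((∑ w ∈ S, ‖z w‖ : ℝ) : ℂ) := by push_cast; rfl
  rw [hre, Complex.norm_real, Real.norm_eq_abs,
    abs_of_nonneg (Finset.sum_nonneg fun w _ => norm_nonneg _)]
  calc m * Y ≤ #S * Y := mul_le_mul_of_nonneg_right hgood hY.le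
    _ = ∑ _w ∈ S, Y := by rw [Finset.sum_const, nsmul_eq_mul]
    _ ≤ ∑ w ∈ S, ‖z w‖ := Finset.sum_le_sum hSz

end Summit.Parity.GeneralizedHardyLittlewood.GreenTaoLevelTwoMNTwoDichotomy
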